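import Summits.CriticalPhenomena.PercolationContinuityZ3.Theorems.PercNearOneGluingNoHeavyLowerTailKNGoodGCThreeTwinAffine
import Literature.Probability.Percolation.KozmaNitzanSeparatingTriple
import HarnessLib

/-!
# A pair closing a SURE path of length two is irrelevant for the goodness functional
# (`NoHeavyLowerTail` cell, stmt-CriticalPhenomena-4575; prover `prim-hp-2`, deletion–contraction line, gen 12)

Support file (`--supports stmt-CriticalPhenomena-4575`).  No definitions, no named facts, no sorries.
Memo: `run/shared/lean/prim/prim-hp-2/MEMO-gen12-gc-three-relays.md` §7 (lemma L2 of the assembly plan for the three-relay GC).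

If the pairs `s(p,q)` and `s(q,r)` are SURE under `u` (weight `1`), then `p` and `r` are almost surely joined, so opening or closing the pair
`s(p,r)` changes no connection event: `μ_{u[s(p,r)↦t]}(S) = μ_{u[s(p,r)↦0]}(S)` for every event `S` that is invariant under inserting
`s(p,r)` into configurations in which `p ↔ r` (`KNGoodGC3.real_update_eq_of_surePath`; instances: `openConn`, `clusterIs`).  Consequence for
Kozma–Nitzan's goodness functional with explicit witness,
`agood(u, x; j) = μ_u(x↔b) − μ_u(j↔b) + Σ_{W∩A=∅} μ_u(C(x)=W)·min_a μ_u(a↔b off W)`: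

* `KNGoodGC3.agood_update_surePath` — for an observer `x ∈ {p, q}`:  `agood(u[s(p,r)↦t], x; j) = agood(u[s(p,r)↦0], x; j)`.
  (The minima only see pockets `W ∋ x`; a pocket missing `p` is null when `x = q` since `s(q,p)` is sure, and a pocket containing `p` does
  not feel `s(p,r)`.)
Use (memo §7, phase 2): in the glued graph `(G−o)+xy` a sure hair `y–a` of the twin may be replaced by the sure hair `x–a`
(close `s(x,a)` along `x–y–a`, then open... i.e. forget `s(y,a)` along `y–x–a`), turning the two pendant stars into ONE star at `x`.
[cite: KozmaNitzan2024, §3.2 Definition (p. 12); folklore (contraction of sure pairs)]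
-/

noncomputable section

namespace Summit.CriticalPhenomena.PercolationContinuityZ3.Theorems

open MeasureTheory Set Literature.Probability.LatticeModels Literature.Probability.Percolation
open scoped Classical BigOperators

variable {n : ℕ}

namespace KNGoodGC3

open ChampionStability KNGoodAux KNGoodHair KNGoodSeries KNGoodPortFree

/-- Opening a pair between two already joined vertices changes no connection. [folklore] -/
theorem reachable_insert_of_joined (ω : BondConfig (Fin n)) {p r : Fin n} (hpr : p ≠ r)
    (hj : (openGraph ω).Reachable p r) (a b : Fin n) :
    (openGraph (insert s(p, r) ω)).Reachable a b ↔ (openGraph ω).Reachable a b := by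
  constructor
  · intro h
    rcases (reachable_insert_iff ω hpr a b).1 h with h | ⟨⟨s, hs, has⟩, ⟨s', hs', hsb⟩⟩
    · exact h
    · have hss' : (openGraph ω).Reachable s s' := by
        simp only [Finset.mem_insert, Finset.mem_singleton] at hs hs'
        rcases hs with rfl | rfl <;> rcases hs' with rfl | rfl
        · exact SimpleGraph.Reachable.refl _
        · exact hj
        · exact hj.symm
        · exact SimpleGraph.Reachable.refl _
      exact (has.trans hss').trans hsb
  · exact fun h => h.mono (openGraph_mono (subset_insert _ _))

/-- **A pair closing a sure path is irrelevant.**  `p, q, r` distinct, `u s(p,q) = 1 = u s(q,r)`; `S` an event such that inserting `s(p,r)`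
into a configuration in which `p ↔ r` does not change membership.  Then `μ_{u[s(p,r)↦t]}(S) = μ_{u[s(p,r)↦0]}(S)`. [folklore] -/
theorem real_update_eq_of_surePath (u : Sym2 (Fin n) → unitInterval) {p q r : Fin n} (hpq : p ≠ q) (hqr : q ≠ r) (hpr : p ≠ r)
    (h1 : u s(p, q) = 1) (h2 : u s(q, r) = 1) (S : Set (BondConfig (Fin n)))
    (hS : ∀ ω : BondConfig (Fin n), (openGraph ω).Reachable p r → (insert s(p, r) ω ∈ S ↔ ω ∈ S)) (t : unitInterval) :
    (prodBernoulli (Function.update u s(p, r) t)).real S = (prodBernoulli (Function.update u s(p, r) 0)).real S := by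
  set e : Sym2 (Fin n) := s(p, r) with he
  set u0 : Sym2 (Fin n) → unitInterval := Function.update u e 0 with hu0
  have hdec := stub_oneBondDecomp_k15 n (Function.update u e t) e S
  rw [Function.update_idem, Function.update_idem, Function.update_self] at hdec
  -- `μ_{u[e↦1]}(S) = μ_{u[e↦0]}((insert e)⁻¹ S) = μ_{u[e↦0]}(S)`
  have hlift : (prodBernoulli (Function.update u e 1)).real S =
      (prodBernoulli u0).real ((fun ω : BondConfig (Fin n) => insert e ω) ⁻¹' S) := by
    have := tieLiftTwo_real_update_one u0 e S
    rwa [hu0, Function.update_idem] at this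
  have hne1 : s(p, q) ≠ e := by
    rw [he]; intro h
    rcases Sym2.eq_iff.1 h with ⟨_, h⟩ | ⟨h, _⟩
    · exact hqr h
    · exact hpr h
  have hne2 : s(q, r) ≠ e := by
    rw [he]; intro h
    rcases Sym2.eq_iff.1 h with ⟨h, _⟩ | ⟨_, h⟩
    · exact hpq h.symm
    · exact hpr h.symm
  have hsame : (prodBernoulli u0).real ((fun ω : BondConfig (Fin n) => insert e ω) ⁻¹' S) = (prodBernoulli u0).real S := by
    refine KNSep.real_eq_of_inter_sureSet u0 ?_
    ext ω
    simp only [mem_inter_iff, mem_preimage]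
    constructor
    · rintro ⟨hωS, hω⟩
      refine ⟨(hS ω ?_).1 hωS, hω⟩
      have hpq' : s(p, q) ∈ ω := (hω s(p, q)).2 (by rw [hu0, Function.update_of_ne hne1, h1])
      have hqr' : s(q, r) ∈ ω := (hω s(q, r)).2 (by rw [hu0, Function.update_of_ne hne2, h2])
      exact ((openGraph_adj ω p q).2 ⟨hpq', hpq⟩).reachable.trans ((openGraph_adj ω q r).2 ⟨hqr', hqr⟩).reachable
    · rintro ⟨hωS, hω⟩
      refine ⟨(hS ω ?_).2 hωS, hω⟩
      have hpq' : s(p, q) ∈ ω := (hω s(p, q)).2 (by rw [hu0, Function.update_of_ne hne1, h1])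
      have hqr' : s(q, r) ∈ ω := (hω s(q, r)).2 (by rw [hu0, Function.update_of_ne hne2, h2])
      exact ((openGraph_adj ω p q).2 ⟨hpq', hpq⟩).reachable.trans ((openGraph_adj ω q r).2 ⟨hqr', hqr⟩).reachable
  rw [hdec, hlift, hsame, hu0]
  ring

/-- Instance: connection events. [folklore] -/
theorem real_openConn_update_surePath (u : Sym2 (Fin n) → unitInterval) {p q r : Fin n} (hpq : p ≠ q) (hqr : q ≠ r) (hpr : p ≠ r)
    (h1 : u s(p, q) = 1) (h2 : u s(q, r) = 1) (a b : Fin n) (t : unitInterval) :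
    (prodBernoulli (Function.update u s(p, r) t)).real (openConn a b) =
      (prodBernoulli (Function.update u s(p, r) 0)).real (openConn a b) :=
  real_update_eq_of_surePath u hpq hqr hpr h1 h2 _
    (fun ω hω => by
      show (openGraph (insert s(p, r) ω)).Reachable a b ↔ (openGraph ω).Reachable a b
      exact reachable_insert_of_joined ω hpr hω a b) t

/-- Instance: cluster events `{C(x) = W}`. [folklore] -/
theorem real_clusterIs_update_surePath (u : Sym2 (Fin n) → unitInterval) {p q r : Fin n} (hpq : p ≠ q) (hqr : q ≠ r) (hpr : p ≠ r)
    (h1 : u s(p, q) = 1) (h2 : u s(q, r) = 1) (x : Fin n) (W : Finset (Fin n)) (t : unitInterval) :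
    (prodBernoulli (Function.update u s(p, r) t)).real (clusterIs x W) =
      (prodBernoulli (Function.update u s(p, r) 0)).real (clusterIs x W) :=
  real_update_eq_of_surePath u hpq hqr hpr h1 h2 _
    (fun ω hω => by
      rw [mem_clusterIs, mem_clusterIs]
      have : openCluster (insert s(p, r) ω) x = openCluster ω x := by
        ext y
        exact reachable_insert_of_joined ω hpr hω x y
      rw [this]) t

/-- **The goodness functional does not feel a pair closing a sure path through the observer's side.**  `p, q, r` distinct,
`u s(p,q) = 1 = u s(q,r)`, observer `x = p` or `x = q`, any `j, b`, any relay set `A`: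
`agood(u[s(p,r)↦t], x; j) = agood(u[s(p,r)↦0], x; j)`. [cite: KozmaNitzan2024, §3.2 Definition (p. 12); folklore] -/
theorem agood_update_surePath (u : Sym2 (Fin n) → unitInterval) (A : Finset (Fin n)) (hA : A.Nonempty) {p q r : Fin n}
    (hpq : p ≠ q) (hqr : q ≠ r) (hpr : p ≠ r) (h1 : u s(p, q) = 1) (h2 : u s(q, r) = 1)
    (x j b : Fin n) (hx : x = p ∨ x = q) (t : unitInterval) :
    (prodBernoulli (Function.update u s(p, r) t)).real (openConn x b) -
        (prodBernoulli (Function.update u s(p, r) t)).real (openConn j b) +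
        ∑ W ∈ nullSets A, (prodBernoulli (Function.update u s(p, r) t)).real (clusterIs x W) *
          A.inf' hA (fun a' => (prodBernoulli (Function.update u s(p, r) t)).real (openConnIn ((↑W : Set (Fin n))ᶜ) a' b)) =
      (prodBernoulli (Function.update u s(p, r) 0)).real (openConn x b) -
        (prodBernoulli (Function.update u s(p, r) 0)).real (openConn j b) +
        ∑ W ∈ nullSets A, (prodBernoulli (Function.update u s(p, r) 0)).real (clusterIs x W) *
          A.inf' hA (fun a' => (prodBernoulli (Function.update u s(p, r) 0)).real (openConnIn ((↑W : Set (Fin n))ᶜ) a' b)) := by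
  rw [real_openConn_update_surePath u hpq hqr hpr h1 h2 x b t, real_openConn_update_surePath u hpq hqr hpr h1 h2 j b t]
  congr 1
  refine Finset.sum_congr rfl fun W _ => ?_
  rw [real_clusterIs_update_surePath u hpq hqr hpr h1 h2 x W t]
  by_cases hpW : p ∈ W
  · -- the minima do not feel a pair at `p ∈ W`
    congr 1
    refine Finset.inf'_congr hA rfl fun a' _ => ?_
    rw [real_update_eq_of_preimage_insert_eq u s(p, r) _ (preimage_insert_openConnIn_eq W p r a' b hpW) t,
      real_update_eq_of_preimage_insert_eq u s(p, r) _ (preimage_insert_openConnIn_eq W p r a' b hpW) 0]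
  · -- a pocket of `x` missing `p` is null (`x = p`: it misses `x`; `x = q`: the pair `s(q,p)` is sure)
    have h0 : (prodBernoulli (Function.update u s(p, r) 0)).real (clusterIs x W) = 0 := by
      rcases hx with hxp | hxq
      · have hxW : x ∉ W := by rw [hxp]; exact hpW
        have : (clusterIs x W : Set (BondConfig (Fin n))) = ∅ := by
          ext ω
          simp only [mem_empty_iff_false, iff_false]
          intro hω
          rw [mem_clusterIs] at hω
          have : x ∈ openCluster ω x := mem_openCluster_self ω x
          rw [hω, Finset.mem_coe] at this
          exact hxW this
        rw [this, measureReal_empty]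
      · have hxp' : x ≠ p := by rw [hxq]; exact hpq.symm
        have hne : s(x, p) ≠ s(p, r) := by
          intro h
          rcases Sym2.eq_iff.1 h with ⟨h, _⟩ | ⟨h, _⟩
          · exact hxp' h
          · exact hqr (hxq.symm.trans h)
        have hval : Function.update u s(p, r) 0 s(x, p) = 1 := by
          rw [Function.update_of_ne hne, hxq, Sym2.eq_swap, h1]
        have hupd : Function.update (Function.update u s(p, r) 0) s(x, p) 1 = Function.update u s(p, r) 0 := by
          rw [← hval]; exact Function.update_eq_self _ _
        rw [← hupd]
        exact real_clusterIs_update_one_eq_zero _ x p hxp' W hpW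
    rw [h0, zero_mul, zero_mul]

end KNGoodGC3

end Summit.CriticalPhenomena.PercolationContinuityZ3.Theorems

end
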